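import Literature.AnabelianGeometry.EtaleTheta.KummerDataOfCore
import Literature.AnabelianGeometry.EtaleTheta.ThetaKummerClass
import Literature.AnabelianGeometry.EtaleTheta.ContH1Injectivity
import Mathlib.Tactic.LinearCombination
import HarnessLib

/-!
# A `ThetaKummerInput` with GENUINE cyclotome coefficients from a Kummer core, compatible with its Kummer
# data (`ConstCompat`) — non-vacuity of the junction hypotheses of the Kummer-function route (proof-only)

Mochizuki, *The étale theta function …*, Publ. RIMS **45** (2009) [EtTh], §1, Prop. 1.3 p. 21 "the composite of the
Kummer map `O^×_K̈ → H¹(G_K̈, Δ_Θ)` with the natural map `H¹(G_K̈, Δ_Θ) → H¹(Π^tp_Ÿ, Δ_Θ)`", Prop. 1.4 (iii) p. 22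
[cite: MochizukiEtTh2009, Prop 1.4 (iii) p.22]. PROOF-ONLY file of the abc-iut cell (prover abc-iut-w5-d125 gen 3;
NV-L2 programme), over abc-iut-L2-t12's `ThetaKummerInput` / `ConstCompat` (`ThetaKummerClass.lean`) and
abc-iut-w5-d171's `KummerCore` / `KummerCore.toKummerData` (`KummerDataOfCore.lean`, p429053). Nothing of either is
edited or restated.

STATUS OF THE INTERFACE: abc-iut-w5-d047 (p427096/p427150) showed that `ThetaKummerInput D` is inhabited over EVERY `D`
by the trivial function group, and that at the root model EVERY coefficient map `Λ(Fn) → Δ_Θ` is trivial. THIS FILE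
gives the complementary GENUINE-COEFFICIENT producer: wherever a Kummer core `C : D.KummerCore` exists (a bijective
equivariant `Ẑ(1) = Λ(ℚ̄_p^×) ≅ Δ_Θ`; none at the root model, one at the χ-twisted model of the R78 cluster), the
constants `ℚ̄_p^×` — with `Π^tp_X` acting through the augmentation — form a `ThetaKummerInput` whose

* coefficient map IS `C`'s bijection (`Function.Bijective T.coeff.hom`);
* constants are `K̈^× ↪ ℚ̄_p^×` with the canonical compatible roots, so that abc-iut-L2-t12's junction hypothesis
  **`T.ConstCompat C.toKummerData`** ("`inflTheta ∘ kumYdd =` the bridge's Kummer class of the constant") HOLDS — on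
  the nose at cocycle level, because `aug = augTheta ∘ toTheta`;
* "`Θ̈`" is the constant `θ ∈ K̈^×` (HONEST LABEL: constants-only function group — genuine Kummer THEORY, degenerate
  FUNCTION; the function-level hypotheses `hdeck`/`hpow`/`hη` of the Kummer-function route stay meaningless here), with
  `T.kummerTheta = T.kummerConst θ` and `T.kummerTheta = 1 ↔ θ = 1` (injectivity of `kumYdd`, p429053, and of
  inflation along `Π^tp_Ÿ ↠ (Π^tp_Ÿ)^Θ`, `ContH1.infl_injective_of_surjective`).

Main statement: `ThetaSetting.KummerCore.exists_thetaKummerInput_constCompat`. No definition, no Prop fact; nothing of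
[EtTh] is asserted; no side is taken on [IUTchIII] Cor. 3.12; typed ≠ proved; inhabited ≠ endorsed.
-/

noncomputable section

namespace Literature.AnabelianGeometry.EtaleTheta

open Literature.AnabelianGeometry.SemiGraphs

namespace ThetaSetting

namespace KummerCore

variable {p : ℕ} [Fact p.Prime] {D : ThetaSetting p} (C : D.KummerCore)

omit C in
/-- `-1 ≠ 1` in `K̈^×` (`K̈ ⊆ ℚ̄_p` has characteristic `0`). [cite: MochizukiEtTh2009, §1 p.17] -/
private theorem neg_one_units_Kdd_ne_one : (-1 : (↥D.Kdd)ˣ) ≠ 1 := by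
  intro h
  have h1 : ((-1 : (↥D.Kdd)ˣ) : D.Kdd) = ((1 : (↥D.Kdd)ˣ) : D.Kdd) := by rw [h]
  rw [Units.val_neg, Units.val_one] at h1
  have h2 : ((-1 : D.Kdd) : PadicAlgCl p) = ((1 : D.Kdd) : PadicAlgCl p) := by rw [h1]
  simp only [IntermediateField.coe_neg, IntermediateField.coe_one] at h2
  exact two_ne_zero (by linear_combination -h2 : (2 : PadicAlgCl p) = 0)

include C in
/-- `aug(Π^tp_Ÿ) ≤ G_K̈` through a Kummer core (`augTheta((Π^tp_Ÿ)^Θ) = G_K̈` and `aug = augTheta ∘ toTheta`).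
[cite: MochizukiEtTh2009, §1 p.17] -/
theorem aug_mem_fixingSubgroup_Kdd_of_mem_GtpYdd {h : D.PiTemp} (hh : h ∈ D.GtpYdd) :
    D.aug.toMonoidHom h ∈ D.Kdd.fixingSubgroup := by
  rw [← C.map_augTheta_gtpYdd]
  refine ⟨D.toTheta h, ⟨h, hh, rfl⟩, ?_⟩
  exact C.augTheta_toTheta h

/-- **A `ThetaKummerInput` with genuine coefficients, compatible with the core's Kummer data.** For every
`θ ∈ K̈^×` there is `T : D.ThetaKummerInput` — constants `ℚ̄_p^×` acted on through `aug`, `Θ̈ := θ`, coefficients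
`= C.coeffHom` — with bijective coefficient map, `ConstCompat` w.r.t. `C.toKummerData`, `κ_Θ̈ = κ(θ)`, and
`κ_Θ̈ = 1 ↔ θ = 1`. [cite: MochizukiEtTh2009, Prop 1.4 (iii) p.22] -/
theorem exists_thetaKummerInput_constCompat (θ : (↥D.Kdd)ˣ) :
    ∃ T : D.ThetaKummerInput, Function.Bijective T.coeff.hom ∧ T.ConstCompat C.toKummerData ∧
      T.kummerTheta = T.kummerConst θ ∧ (T.kummerTheta = 1 ↔ θ = 1) := by
  -- `Π^tp_X` acts on `ℚ̄_p^×` through `aug : Π^tp_X → G_{ℚ_p}`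
  letI instA : MulDistribMulAction D.PiTemp (PadicAlgCl p)ˣ :=
    MulDistribMulAction.compHom _ (D.aug.toMonoidHom : D.PiTemp →* GQp p)
  have hsmul : ∀ (g : D.PiTemp) (u : (PadicAlgCl p)ˣ), g • u = (D.aug.toMonoidHom g) • u := fun _ _ => rfl
  -- open stabilisers (discrete Galois module + continuity of `aug`)
  have hopen : ∀ f : (PadicAlgCl p)ˣ, IsOpen (MulAction.stabilizer D.PiTemp f : Set D.PiTemp) := by
    intro f
    have h : (MulAction.stabilizer D.PiTemp f : Set D.PiTemp) =
        D.aug ⁻¹' (MulAction.stabilizer (GQp p) f : Set (GQp p)) := by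
      ext g; rfl
    rw [h]
    exact (isOpen_stabilizer_absoluteGaloisGroup_units ℚ_[p] f).preimage (map_continuous D.aug)
  -- the constants `K̈^× → ℚ̄_p^×` and their `Π^tp_Ÿ`-invariance
  let cst : (↥D.Kdd)ˣ →* (PadicAlgCl p)ˣ :=
    Units.map (algebraMap (↥D.Kdd) (PadicAlgCl p) : ↥D.Kdd →* PadicAlgCl p)
  have hcst : ∀ c, (cst c : PadicAlgCl p) = ((c : ↥D.Kdd) : PadicAlgCl p) := fun _ => rfl
  have hcst_mem : ∀ c, cst c ∈ MulAction.fixedPoints D.GtpYdd (PadicAlgCl p)ˣ := by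
    intro c h
    show (h : D.PiTemp) • cst c = cst c
    rw [hsmul]
    exact KummerCore.smul_eq_of_coe_mem D.Kdd (cst c) (by rw [hcst]; exact (c : ↥D.Kdd).2) _
      (C.aug_mem_fixingSubgroup_Kdd_of_mem_GtpYdd h.2)
  -- the coefficient structure for the action through `toTheta` (same `coeffHom`)
  let coeffT : CyclotomeCoefficients D.toTheta D.DeltaTheta (PadicAlgCl p)ˣ :=
    { hom := C.coeffHom
      continuous_hom := C.continuous_coeffHom
      hom_smul := fun g ζ => by
        have h1 : (g • ζ : cyclotome (PadicAlgCl p)ˣ) = (C.augTheta (D.toTheta g)) • ζ := by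
          apply Subtype.ext
          funext n
          show g • (ζ : ℕ+ → (PadicAlgCl p)ˣ) n = (C.augTheta (D.toTheta g)) • (ζ : ℕ+ → (PadicAlgCl p)ˣ) n
          rw [hsmul, C.augTheta_toTheta]
          rfl
        rw [h1]
        exact C.coeffHom_smul (D.toTheta g) ζ }
  -- the input
  let T : D.ThetaKummerInput :=
    { Fn := (PadicAlgCl p)ˣ
      isOpen_stabilizer := hopen
      theta := cst θ
      theta_mem := hcst_mem θ
      thetaRoots := RootSystem.ofRootableBy (cst θ)
      const := cst
      const_mem := hcst_mem
      constRoots := fun c => RootSystem.ofRootableBy (cst c)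
      coeff := coeffT }
  have hTtheta : T.kummerTheta = T.kummerConst θ := rfl
  -- `ConstCompat`: inflation of the `(Π^tp_Ÿ)^Θ`-class is the `Π^tp_Ÿ`-class of the same root system
  have hCC : T.ConstCompat C.toKummerData := by
    intro c
    letI := D.unitsAction C.augTheta
    -- unfold both sides to `ContH1.mk` of explicit cocycles
    show D.inflTheta D.GtpYdd
        (C.coeff.kummerContMap (D.GtpYdd.map D.toTheta) C.isOpen_stabilizer' (C.toInvYdd c)) =
      T.coeff.kummerContClass D.GtpYdd (T.constRoots c) (T.const_mem c) fun _ => T.isOpen_stabilizer _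
    rw [C.coeff.kummerContMap_apply_eq (D.GtpYdd.map D.toTheta) C.isOpen_stabilizer' (C.toInvYdd c)
      (RootSystem.ofRootableBy ((C.toInvYdd c : C.invYdd) : (PadicAlgCl p)ˣ))]
    show ContH1.infl D.DeltaTheta D.toTheta D.continuous_toTheta le_rfl (ContH1.mk _ _) = ContH1.mk _ _
    refine (ContH1.mk_congr D.GtpYdd ?_ _ _)
    funext h
    -- both sides are `C.coeffHom` of a Kummer cocycle of the SAME root system of the SAME unit
    show C.coeffHom ((RootSystem.ofRootableBy ((C.toInvYdd c : C.invYdd) : (PadicAlgCl p)ˣ)).kummerCocycle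
        (C.toInvYdd c).2 ⟨D.toTheta h.1, ⟨h.1, h.2, rfl⟩⟩) =
      C.coeffHom ((RootSystem.ofRootableBy (cst c)).kummerCocycle (hcst_mem c) h)
    congr 1
    apply Subtype.ext
    funext n
    show (C.augTheta (D.toTheta h.1)) • (RootSystem.ofRootableBy (cst c)).root n /
        (RootSystem.ofRootableBy (cst c)).root n =
      (h : D.PiTemp) • (RootSystem.ofRootableBy (cst c)).root n / (RootSystem.ofRootableBy (cst c)).root n
    rw [hsmul, C.augTheta_toTheta]
    rfl
  -- `κ_Θ̈ = 1 ↔ θ = 1`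
  have hiff : T.kummerTheta = 1 ↔ θ = 1 := by
    rw [hTtheta, ← hCC θ]
    constructor
    · intro h1
      have hsurj : ∀ y : ↥(D.GtpYdd.map D.toTheta), ∃ x : ↥D.GtpYdd, D.toTheta x = y := by
        rintro ⟨_, g, hg, rfl⟩
        exact ⟨⟨g, hg⟩, rfl⟩
      have hinj : Function.Injective (D.inflTheta D.GtpYdd) := by
        unfold ThetaSetting.inflTheta
        exact ContH1.infl_injective_of_surjective _ hsurj
      have h2 : C.toKummerData.kumYdd (C.toKummerData.toKddHat θ) = 1 := hinj (by rw [map_one]; exact h1)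
      have h3 : C.toKummerData.toKddHat θ = 1 :=
        C.toKummerData.kumYdd_injective (by rw [h2, map_one])
      exact C.toKummerData.toKddHat_injective (by rw [h3, map_one])
    · rintro rfl
      rw [map_one, map_one, map_one]
  exact ⟨T, C.bijective_coeffHom, hCC, hTtheta, hiff⟩

/-- In particular a `ThetaKummerInput` with BIJECTIVE coefficients and NON-TRIVIAL Kummer class of "`Θ̈`" exists over any
`D` carrying a Kummer core (take `θ := -1`, or any `θ ≠ 1`). [cite: MochizukiEtTh2009, Prop 1.4 (iii) p.22] -/
theorem exists_thetaKummerInput_bijective_ne_one :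
    ∃ T : D.ThetaKummerInput, Function.Bijective T.coeff.hom ∧ T.ConstCompat C.toKummerData ∧ T.kummerTheta ≠ 1 := by
  obtain ⟨T, hb, hc, -, hiff⟩ := C.exists_thetaKummerInput_constCompat (-1)
  exact ⟨T, hb, hc, fun h => neg_one_units_Kdd_ne_one (hiff.mp h)⟩

end KummerCore

end ThetaSetting

end Literature.AnabelianGeometry.EtaleTheta

end
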